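import Summits.ResolutionOfSingularities.ResolutionOfSingularities.Theorems.FrobeniusClosingSteerFreeChainBound
import Summits.ResolutionOfSingularities.ResolutionOfSingularities.Theorems.FrobeniusClosingSteerFreeStepCoeffDerivation
import Summits.ResolutionOfSingularities.ResolutionOfSingularities.Theorems.FrobeniusClosingSteerNestedCohenFrames
import Summits.ResolutionOfSingularities.ResolutionOfSingularities.Theorems.FrobeniusClosingSteerIsolatedJacobianColength
import Literature.RingTheory.Derivation.MvPowerSeriesPBasisChainRule
import HarnessLib

/-!
# Crux `Steer` (stmt-ResolutionOfSingularities-16345), chain W4.1, hGW3 WORK-MODULO: **Lemma F♭_λ — THE BRIDGE for residue fields of finite `2`-rank**: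
# no eternal ALL-FREE RATIONAL chain carrying an isolated `2`-radicand, given a finite `2`-basis dual frame of `κ(Ŝ₀)`

OURS (campaign `res-hironaka`, rung L ★L-G4, slot W4.1; seat res-L0-w41-stub-2 g6, res-L0-w41-plan-1 RULING 165b «F♭_λ by the same engine»; spec =
res-L0-w41-idea-3 `G-GEOM-DIRECT.md` v1.1 §3 + res-L0-w41-tri-1 TRIAGE v6.19 R-GG; replaces the role of no printed item; NOT a statement of the manuscript under
review [claim: Hironaka2017, status: under-review]; AI-produced, weaker than expert review). Theses-free, definition-free.

THE BRIDGE (imperfect residue fields allowed): `FreeChainBound.exists_free_chain_data` (p545217) · `NestedFrames.exists_nested_frames` (p550901: frames of `Ŝ₀`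
and `Ŝ_M` with NESTED coefficient fields, the free substitution `θ_M` read exactly) · the telescoped law ⟹ `θ_M F = Ψ² + x^(M·2e) G` for `F := frame₀ (f̂₀)` ·
`G3Perf.milnorLengthPlus_ge_of_substGenerators_eq` (p546216) ⟹ `M − 1 ≤ τ⁺(F)` · res-L0-w41-stub-3's K1′ `IsolatedColength.length_quotient_span_jacobian_lt_top_of_isolated`
⟹ `τ⁺(F) < ∞` · `span_derivation_eq_span_jacobian` (the `2`-basis chain rule `derivation_apply_eq_sum_frame`) + `JacobianLength.length_quotient_jacobian_eq_of_ringEquiv`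
(p542444) ⟹ `τ⁺(F) = ℓ(Ŝ₀ ⧸ 𝒥_abs(f̂₀))` does not depend on `M`.

* `FreeChainBoundPBasis.span_derivation_eq_span_jacobian` — over `κ⟦X⟧` with a `p`-basis dual frame `(γ, D)`: `(Δ F)_{Δ ∈ Der_ℤ} = (∂ᵢ F, D̃_l F)`;
* `FreeChainBoundPBasis.milnorLengthPlus_completion_ge` — **after `M ≥ 1` rational free steps, `M − 1 ≤ ℓ(Ŝ₀ ⧸ 𝒥_abs(f̂₀)) < ∞`** (no perfectness);
* `FreeChainBoundPBasis.not_eternal_free_rational_chain` — **Lemma F_λ**: an eternal all-free rational chain with isolated stage `0` is impossible.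
The `2`-basis dual frame `(γ, D)` of `κ(Ŝ₀)` is a HYPOTHESIS here (binder shape of K1′); its producer from the `Geom` datum is K-GG5 (res-D-lib-1). [folklore]
-/

noncomputable section

set_option linter.dupNamespace false

open IsLocalRing MvPowerSeries
open Literature.AlgebraicGeometry.Resolution Literature.RingTheory.MvPowerSeries Literature.RingTheory.MvPowerSeries.monoidPowerSeries
open Literature.RingTheory.Derivation Literature.FieldTheory.Separability
open Summit.ResolutionOfSingularities.ResolutionOfSingularities.Theorems.SwitchingDichotomy
open Summit.ResolutionOfSingularities.ResolutionOfSingularities.Theorems.SwitchingDichotomy.ChartMonomialSubst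

namespace Summit.ResolutionOfSingularities.ResolutionOfSingularities.Theorems.SwitchingDichotomy.FreeChainBoundPBasis

/-! ## The absolute Jacobian ideal over a field with a finite `p`-basis dual frame -/

/-- **`(Δ F)_{Δ ∈ Der_ℤ(κ⟦X⟧)} = (∂ᵢ F, D̃_l F)`** for a `p`-basis dual frame `(γ, D)` of `κ` (`D_l γ_{l′} = δ`, `κ = κ^p(γ)`): every `ℤ`-derivation factors through
the frame (`derivation_apply_eq_sum_frame`), and the frame members are `ℤ`-derivations. [cite: Matsumura1987, Thm. 30.6 (i)] -/
theorem span_derivation_eq_span_jacobian (p : ℕ) [Fact p.Prime] {κ : Type} [Field κ] [CharP κ p] {n r : ℕ} (γ : Fin r → κ)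
    (D : Fin r → Derivation ℤ κ κ) (hdual : ∀ l l', D l (γ l') = if l' = l then 1 else 0) (hgen : pAdjoin p (Set.range γ) = ⊤)
    (F : MvPowerSeries (Fin n) κ) :
    Ideal.span (Set.range fun Δ : Derivation ℤ (MvPowerSeries (Fin n) κ) (MvPowerSeries (Fin n) κ) => Δ F) =
      Ideal.span (Set.range (fun i : Fin n => MvPowerSeries.pderiv i F) ∪ Set.range (fun l => (D l).mvPowerSeriesCoeffwise F)) := by
  classical
  apply le_antisymm
  · rw [Ideal.span_le]
    rintro _ ⟨Δ, rfl⟩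
    change Δ F ∈ _
    rw [derivation_apply_eq_sum_frame p γ D hdual hgen Δ F]
    refine Ideal.add_mem _ (Ideal.sum_mem _ fun i _ => ?_) (Ideal.sum_mem _ fun l _ => ?_)
    · rw [smul_eq_mul, mul_comm]
      exact Ideal.mul_mem_left _ _ (Ideal.subset_span (Or.inl ⟨i, rfl⟩))
    · rw [smul_eq_mul, mul_comm]
      exact Ideal.mul_mem_left _ _ (Ideal.subset_span (Or.inr ⟨l, rfl⟩))
  · rw [Ideal.span_le]
    rintro _ (⟨i, rfl⟩ | ⟨l, rfl⟩)
    · exact Ideal.subset_span ⟨(MvPowerSeries.pderiv i).restrictScalars ℤ, rfl⟩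
    · exact Ideal.subset_span ⟨(D l).mvPowerSeriesCoeffwise, rfl⟩

/-! ## Small algebra -/

/-- The monomial `∏_j v_j ^ (X^{gch i})_j` of the free chart at letter `0` with weight `M`: `v 0` for `i = 0`, `v 0 ^ M · v i` otherwise. -/
theorem prod_pow_chartExp {R : Type} [CommMonoid R] (v : Fin 3 → R) (M : ℕ) (i : Fin 3) :
    ∏ j, v j ^ ((Finsupp.single i 1 + if i = 0 then 0 else M • Finsupp.single (0 : Fin 3) 1 : Fin 3 →₀ ℕ) j) =
      if i = 0 then v 0 else v 0 ^ M * v i := by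
  classical
  have hsingle : ∀ (k : Fin 3) (n : ℕ), ∏ j, v j ^ ((Finsupp.single k n : Fin 3 →₀ ℕ) j) = v k ^ n := by
    intro k n
    rw [Finset.prod_eq_single k (fun j _ hj => by rw [Finsupp.single_apply, if_neg (Ne.symm hj), pow_zero])
      (fun h => absurd (Finset.mem_univ k) h), Finsupp.single_eq_same]
  simp_rw [Finsupp.add_apply, pow_add, Finset.prod_mul_distrib, hsingle, pow_one]
  split_ifs with hi
  · simp_rw [Finsupp.coe_zero, Pi.zero_apply, pow_zero, Finset.prod_const_one, mul_one]
    rw [hi]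
  · simp_rw [Finsupp.smul_apply, smul_eq_mul, pow_mul', Finset.prod_pow, hsingle, pow_one, mul_comm]

/-- Undo a coefficient isomorphism on a reading `ρ_* T = A² + X₀^k · G`. -/
theorem eq_sq_add_of_map_eq {K K' : Type} [Field K] [Field K'] (ρ : K ≃+* K') {k : ℕ} {T : MvPowerSeries (Fin 3) K}
    {A G : MvPowerSeries (Fin 3) K'} (h : MvPowerSeries.map (ρ : K →+* K') T = A ^ 2 + X 0 ^ k * G) :
    T = (MvPowerSeries.map (ρ.symm : K' →+* K) A) ^ 2 + X 0 ^ k * MvPowerSeries.map (ρ.symm : K' →+* K) G := by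
  have hback : MvPowerSeries.map (ρ.symm : K' →+* K) (MvPowerSeries.map (ρ : K →+* K') T) = T := by
    ext n; rw [coeff_map, coeff_map]; exact ρ.symm_apply_apply _
  rw [← hback, h, map_add, map_pow, map_mul, map_pow, map_X]

/-! ## Lemma F♭_λ: `M − 1 ≤ τ⁺ < ∞` after `M` rational free steps, for residue fields with a finite `2`-basis dual frame -/

variable {L : Type} [Field L] [CharP L 2]

/-- **Lemma F♭_λ, quantitative form (no perfectness).** Same chain hypotheses as `FreeChainBound.milnorLength_completion_ge` WITHOUT `PerfectField`, plus a
finite `2`-basis dual frame `(γ, D)` of `κ(Ŝ₀)` (`D_l γ_{l′} = δ`, `κ = κ²(γ)`): then `M − 1 ≤ ℓ(Ŝ₀ ⧸ 𝒥_abs(f̂₀)) < ∞` for every `M ≥ 1`, where `𝒥_abs(h)` is the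
ideal of values at `h` of all `ℤ`-derivations of `Ŝ₀` (it equals `τ⁺` in any frame, `span_derivation_eq_span_jacobian`). [folklore] -/
theorem milnorLengthPlus_completion_ge (e : ℕ) (he : 1 ≤ e) (S : ℕ → Subring L) [∀ m, IsLocalRing (S m)]
    (hle : ∀ m, S m ≤ S (m + 1)) (f g : ∀ m, S m) (x : ∀ m, S (m + 1))
    (hreg : ∀ m, IsRegularLocalRing (S m)) (hexc : IsExcellentRing (S 0)) (hdim : ∀ m, ringKrullDim (S m) = (3 : ℕ))
    (hqt : ∀ m, IsQuadraticTransform (S m) (S (m + 1)))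
    (hspan : ∀ m, (maximalIdeal (S m)).map (Subring.inclusion (hle m)) = Ideal.span {x m})
    (hlaw : ∀ m, ((f (m + 1) : S (m + 1)) : L) * ((x m : S (m + 1)) : L) ^ (2 * e) = ((f m : S m) : L) - ((g m : S m) : L) ^ 2)
    (hiso : ∀ (P : Ideal (AdjoinRoot ((Polynomial.X : Polynomial (S 0)) ^ 2 - Polynomial.C (f 0)))) [P.IsPrime],
      (∃ Q : Ideal (AdjoinRoot ((Polynomial.X : Polynomial (S 0)) ^ 2 - Polynomial.C (f 0))), Q.IsPrime ∧ P < Q) →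
        IsRegularLocalRing (Localization.AtPrime P))
    (hfree : ∀ m, Ideal.span {Subring.inclusion (hle (m + 1)) (x m)} = Ideal.span {x (m + 1)})
    (hrat : ∀ m (z : S (m + 1)), ∃ s : S m, z - Subring.inclusion (hle m) s ∈ maximalIdeal (S (m + 1)))
    [CharP (ResidueField (AdicCompletion (maximalIdeal (S 0)) (S 0))) 2]
    {r : ℕ} (γ : Fin r → ResidueField (AdicCompletion (maximalIdeal (S 0)) (S 0)))
    (D : Fin r → Derivation ℤ (ResidueField (AdicCompletion (maximalIdeal (S 0)) (S 0))) (ResidueField (AdicCompletion (maximalIdeal (S 0)) (S 0))))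
    (hdual : ∀ l l', D l (γ l') = if l' = l then 1 else 0) (hgen : pAdjoin 2 (Set.range γ) = ⊤)
    {M : ℕ} (hM : 1 ≤ M) :
    ((M - 1 : ℕ) : ℕ∞) ≤ Module.length (AdicCompletion (maximalIdeal (S 0)) (S 0)) (AdicCompletion (maximalIdeal (S 0)) (S 0) ⧸
        Ideal.span (Set.range fun Dv : Derivation ℤ (AdicCompletion (maximalIdeal (S 0)) (S 0)) (AdicCompletion (maximalIdeal (S 0)) (S 0)) =>
          Dv (algebraMap (S 0) (AdicCompletion (maximalIdeal (S 0)) (S 0)) (f 0)))) ∧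
      Module.length (AdicCompletion (maximalIdeal (S 0)) (S 0)) (AdicCompletion (maximalIdeal (S 0)) (S 0) ⧸
        Ideal.span (Set.range fun Dv : Derivation ℤ (AdicCompletion (maximalIdeal (S 0)) (S 0)) (AdicCompletion (maximalIdeal (S 0)) (S 0)) =>
          Dv (algebraMap (S 0) (AdicCompletion (maximalIdeal (S 0)) (S 0)) (f 0)))) < ⊤ := by
  classical
  haveI : ∀ m, IsRegularLocalRing (S m) := hreg
  haveI : Fact (Nat.Prime 2) := ⟨Nat.prime_two⟩
  obtain ⟨u, yt, wM, Ψ, E, hgen0, hgenM, hrel, hΨ, hrat0⟩ :=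
    FreeChainBound.exists_free_chain_data e S hle f g x hreg hdim hqt hspan hlaw hfree hrat M
  have hwM : ∀ k, wM k ∈ maximalIdeal (S M) := fun k => by
    rw [← hgenM]; exact Ideal.subset_span ⟨k.succ, Fin.cons_succ _ _ _⟩
  have huM : Subring.inclusion (FreeChain.monotone S hle (Nat.zero_le M)) u ∈ maximalIdeal (S M) := by
    rw [← hgenM]; exact Ideal.subset_span ⟨0, Fin.cons_zero _ _⟩
  -- ### nested frames along `S 0 → S M`, the free substitution read exactly
  obtain ⟨frameS, frameT, ρ, hfSx, -, hfTx, -, hsq⟩ := NestedFrames.exists_nested_frames 2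
    (Subring.inclusion (FreeChain.monotone S hle (Nat.zero_le M)))
    (by
      rw [← hgen0, Ideal.map_span, Ideal.span_le]
      rintro _ ⟨_, ⟨i, rfl⟩, rfl⟩
      refine Fin.cases ?_ (fun k => ?_) i
      · rw [Fin.cons_zero]; exact huM
      · rw [Fin.cons_succ, hrel]; exact Ideal.mul_mem_left _ _ (hwM k))
    hrat0 (hdim 0) (hdim M) (Fin.cons u yt) hgen0 (Fin.cons (Subring.inclusion (FreeChain.monotone S hle (Nat.zero_le M)) u) wM) hgenM
    (fun i : Fin 3 => Finsupp.single i 1 + if i = 0 then 0 else M • Finsupp.single 0 1) (chartExp_ne_zero 0 M)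
    (fun i => by
      rw [prod_pow_chartExp]
      refine Fin.cases ?_ (fun k => ?_) i
      · rw [if_pos rfl, Fin.cons_zero, Fin.cons_zero]
      · rw [if_neg (Fin.succ_ne_zero k), Fin.cons_succ, Fin.cons_zero, Fin.cons_succ, hrel])
  -- ### the reading `θ_M F = Ψ'² + X₀^(M·2e) G'`
  have hfT0 : frameT (algebraMap (S M) _ (Subring.inclusion (FreeChain.monotone S hle (Nat.zero_le M)) u)) = X 0 := by
    have := hfTx 0; rwa [Fin.cons_zero] at this
  have hread := hsq (f 0)
  rw [hΨ] at hread
  simp only [map_add, map_mul, map_pow, hfT0] at hread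
  have hθ := eq_sq_add_of_map_eq ρ hread.symm
  -- ### `M − 1 ≤ τ⁺(F) < ∞`
  have hge := G3Perf.milnorLengthPlus_ge_of_substGenerators_eq D (by omega : 2 ≤ 2 * e) hM hθ
  have hfin := IsolatedColength.length_quotient_span_jacobian_lt_top_of_isolated 2 hexc (f 0) hiso frameS γ D hdual hgen
  -- ### intrinsic form (compose by `trans_eq`: the instance paths of `Derivation ℤ` / `Field κ(Ŝ₀)` differ between the generic lemmas)
  have key := span_derivation_eq_span_jacobian 2 γ D hdual hgen (frameS (algebraMap (S 0) (AdicCompletion (maximalIdeal (S 0)) (S 0)) (f 0)))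
  have hge2 := hge.trans_eq (congrArg (fun J => Module.length (MvPowerSeries (Fin 3) (ResidueField (AdicCompletion (maximalIdeal (S 0)) (S 0))))
    (MvPowerSeries (Fin 3) (ResidueField (AdicCompletion (maximalIdeal (S 0)) (S 0))) ⧸ J)) key.symm)
  have hfin2 := (congrArg (fun J => Module.length (MvPowerSeries (Fin 3) (ResidueField (AdicCompletion (maximalIdeal (S 0)) (S 0))))
    (MvPowerSeries (Fin 3) (ResidueField (AdicCompletion (maximalIdeal (S 0)) (S 0))) ⧸ J)) key).trans_lt hfin
  have htransport := JacobianLength.length_quotient_jacobian_eq_of_ringEquiv frameS (algebraMap (S 0) (AdicCompletion (maximalIdeal (S 0)) (S 0)) (f 0))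
  have hrange : ∀ (i₁ i₂ : Algebra ℤ (MvPowerSeries (Fin 3) (ResidueField (AdicCompletion (maximalIdeal (S 0)) (S 0)))))
      (b : MvPowerSeries (Fin 3) (ResidueField (AdicCompletion (maximalIdeal (S 0)) (S 0)))),
      (Set.range fun Dv : @Derivation ℤ (MvPowerSeries (Fin 3) (ResidueField (AdicCompletion (maximalIdeal (S 0)) (S 0))))
          (MvPowerSeries (Fin 3) (ResidueField (AdicCompletion (maximalIdeal (S 0)) (S 0)))) _ _ _ i₁ _ _ => Dv b) =
        Set.range fun Dv : @Derivation ℤ (MvPowerSeries (Fin 3) (ResidueField (AdicCompletion (maximalIdeal (S 0)) (S 0))))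
          (MvPowerSeries (Fin 3) (ResidueField (AdicCompletion (maximalIdeal (S 0)) (S 0)))) _ _ _ i₂ _ _ => Dv b := by
    intro i₁ i₂ b
    obtain rfl : i₁ = i₂ := Algebra.algebra_ext _ _ fun r => (eq_intCast _ r).trans (eq_intCast _ r).symm
    rfl
  have hK := congrArg (fun s => Module.length (MvPowerSeries (Fin 3) (ResidueField (AdicCompletion (maximalIdeal (S 0)) (S 0))))
    (MvPowerSeries (Fin 3) (ResidueField (AdicCompletion (maximalIdeal (S 0)) (S 0))) ⧸ Ideal.span s))
    (hrange (MvPowerSeries.instAlgebra) (Ring.toIntAlgebra _) (frameS (algebraMap (S 0) (AdicCompletion (maximalIdeal (S 0)) (S 0)) (f 0))))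
  exact ⟨(hge2.trans_eq hK).trans htransport.le, htransport.symm.trans_lt (hK.symm.trans_lt hfin2)⟩

/-- **LEMMA F♭_λ (THE BRIDGE, imperfect residue fields).** In characteristic `2` and dimension `3` there is NO ETERNAL ALL-FREE RATIONAL CHAIN of quadratic
transforms carrying `2`-radicands with the law of exponent `2e ≥ 2` whose stage-`0` torsor germ is ISOLATED and `S 0` excellent, PROVIDED `κ(Ŝ₀)` carries a
finite `2`-basis dual frame (finite `2`-rank; producer from the `Geom` datum = K-GG5). `M − 1 ≤ ℓ(Ŝ₀ ⧸ 𝒥_abs f̂₀) < ∞` for all `M` is absurd.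
(The instance `CharP κ(Ŝ₀) 2` is `RadicandCohenFrame.charP_residueField 2` over `charP_adicCompletion`.) [folklore] -/
theorem not_eternal_free_rational_chain (e : ℕ) (he : 1 ≤ e) (S : ℕ → Subring L) [∀ m, IsLocalRing (S m)]
    (hle : ∀ m, S m ≤ S (m + 1)) (f g : ∀ m, S m) (x : ∀ m, S (m + 1))
    (hreg : ∀ m, IsRegularLocalRing (S m)) (hexc : IsExcellentRing (S 0)) (hdim : ∀ m, ringKrullDim (S m) = (3 : ℕ))
    (hqt : ∀ m, IsQuadraticTransform (S m) (S (m + 1)))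
    (hspan : ∀ m, (maximalIdeal (S m)).map (Subring.inclusion (hle m)) = Ideal.span {x m})
    (hlaw : ∀ m, ((f (m + 1) : S (m + 1)) : L) * ((x m : S (m + 1)) : L) ^ (2 * e) = ((f m : S m) : L) - ((g m : S m) : L) ^ 2)
    (hiso : ∀ (P : Ideal (AdjoinRoot ((Polynomial.X : Polynomial (S 0)) ^ 2 - Polynomial.C (f 0)))) [P.IsPrime],
      (∃ Q : Ideal (AdjoinRoot ((Polynomial.X : Polynomial (S 0)) ^ 2 - Polynomial.C (f 0))), Q.IsPrime ∧ P < Q) →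
        IsRegularLocalRing (Localization.AtPrime P))
    (hfree : ∀ m, Ideal.span {Subring.inclusion (hle (m + 1)) (x m)} = Ideal.span {x (m + 1)})
    (hrat : ∀ m (z : S (m + 1)), ∃ s : S m, z - Subring.inclusion (hle m) s ∈ maximalIdeal (S (m + 1)))
    [CharP (ResidueField (AdicCompletion (maximalIdeal (S 0)) (S 0))) 2]
    {r : ℕ} (γ : Fin r → ResidueField (AdicCompletion (maximalIdeal (S 0)) (S 0)))
    (D : Fin r → Derivation ℤ (ResidueField (AdicCompletion (maximalIdeal (S 0)) (S 0))) (ResidueField (AdicCompletion (maximalIdeal (S 0)) (S 0))))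
    (hdual : ∀ l l', D l (γ l') = if l' = l then 1 else 0) (hgen : pAdjoin 2 (Set.range γ) = ⊤) : False := by
  obtain ⟨N, hN⟩ := ENat.ne_top_iff_exists.mp
    (milnorLengthPlus_completion_ge e he S hle f g x hreg hexc hdim hqt hspan hlaw hiso hfree hrat γ D hdual hgen le_rfl).2.ne
  have h := (milnorLengthPlus_completion_ge e he S hle f g x hreg hexc hdim hqt hspan hlaw hiso hfree hrat γ D hdual hgen
    (M := N + 2) (by omega)).1
  rw [← hN] at h
  have h' : N + 1 ≤ N := by exact_mod_cast h
  omega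

end Summit.ResolutionOfSingularities.ResolutionOfSingularities.Theorems.SwitchingDichotomy.FreeChainBoundPBasis

end
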